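import Mathlib
import Summits.Ventures.HodgeRepro.Tier4.Common.KTypeSpace
import Summits.Ventures.HodgeRepro.Tier4.Common.SettingOfData
import Summits.Ventures.HodgeRepro.Tier4.Line1.SpectralOfRTF
import Summits.Ventures.HodgeRepro.Tier4.Line4.W4SpectralBridge
import Summits.Ventures.HodgeRepro.Tier4.Line4.W3Reduction2

/-!
# Tier4/Line4/W3TwoVector — the TWO-VECTOR wall W3⁗ of LINE L4 (v0.24) from the spectral expansion alone: a non-zero
spectral term hands over the two vectors (cut C-L4-2VEC)

Blind re-derivation cell `pub-hodge-repro`, Tier 4 «prove the step» (README §9–§10), seat t4-L1-p5 (prover, gen 3;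
t4-plan-4 g2's cut C-L4-2VEC S13948, taken S13950).  Tree path `lean/Summits/Ventures/HodgeRepro/Tier4/Line4/W3TwoVector.lean`.
Over a GENERIC plane `W` on typer-2's `Setting.ofAdelicData` (the skeleton instantiates `W := seesawPlane …`,
`w₀ := w₀ d`).  Consumes t4-L1-p1 g3's `SpectralOfRTF` (`exists_specBlock_ne_zero`,
`exists_specTerm_ne_zero_of_specBlock_ne_zero`), this seat's g2 bridges (`W4SpectralBridge`: `conj_periodT_eq`,
`periodT'_eq_periodT'conj`, `R_ofAdelicData_eq`), t4-L4-p2's `Jc_eq_J` / `isCharacter_chi` / `isCharacter'_chi'`,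
t4-L1-p2's `conv_isTest`, plan-1's `atoms` — all by name.

WHAT IS PROVED.  `mixed_two_torus_W3_twoVector`: the v0.24 wall's conclusion — some admissible constituent `V₀` and a
level `K₀` with TWO vectors of `kTypeSpace' … K₀ V₀`, one with a non-zero `T′`-period, one with a non-zero `T`-period
(no Riesz vector, no scalar per block, no multiplicity one) — from
* (a) an adapted orthonormal basis `hB` of the setting (the consumer supplies t4-L4-p1 g3's CLOSED one) and a compact
  open level `K`;
* (b″) STABILITY: for every basis vector `φ j`, the conjugates of `R(f̄₁) φ_j` and `R(f₂ˇ) φ_j` lie in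
  `kTypeSpace' … K (V (n j))`, where `V m` is the displayed constituent carrying the conjugate vectors of the ONB's
  constituent `τ m` (on the instance `V m = span (conj '' τ m)`: the period bridges are conjugate-linear, so the
  wall's vectors are the CONJUGATES of the spectral term's vectors) — the projector shape of the test pair (cut
  C-L4-PROJ, displayed);
* (c′) `hJ : Jc(f₁ ⋆ f₂) ≠ 0` — the weak W5 for the projector pair;
* (d) `hadm`: a constituent hit by `f̄₁` is admissible, on the displayed `V m`.
PROOF: `Jc(f₁ ⋆ f₂) = J(f₁ ⋆ f₂) = Σ_m specBlock m` (L1's spectral expansion), so some block and then some term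
`specTerm j = P_{χ′}(R(f₂ˇ)φ_j) · conj P_χ(R(f̄₁)φ_j)` is non-zero (`exists_specTerm_ne_zero_of_specBlock_ne_zero`);
both factors are non-zero; the conjugate-linear period bridges turn them into the non-vanishing of the wall's
`periodLin` on the conjugate vectors; `Hit` from the second factor (`atoms`) gives admissibility of `V (n j)` by (d).
Nothing of the wall's content is proved: (b″), (c′), (d) and the closedness of the ONB are displayed hypotheses.

Nothing here says anything about the status of the Hodge conjecture for CM abelian varieties, which is NOT proved
(HC_CM is NOT proved by anyone in this repository).
-/

set_option autoImplicit false

noncomputable section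

namespace Summit.Ventures.HodgeRepro.Tier4.Line4

open Summit.Ventures.HodgeRepro.Tier4.Common Summit.Ventures.HodgeRepro.Tier4.Line1 MeasureTheory NumberField
open scoped ComplexConjugate

section Bridge

variable {k : Type} [Field k] [NumberField k] (W : PlaneData k) [MeasurableSpace (GA W)] [BorelSpace (GA W)]
  (R : RTFData W) (μ : Measure (GA W)) [μ.IsHaarMeasure] [R.μT.IsHaarMeasure] [R.μT'.IsHaarMeasure]
  (DG : Set (GA W)) (fdG : IsFundamentalDomain (rationalPoints W) DG μ) (compG : IsCompact (closure DG))
  (compT : IsCompact (closure R.DT)) (compT' : IsCompact (closure R.DT'))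

/-- **the `T′`-period of the wall on a conjugate vector is the conjugate of the setting's `T′`-period**:
`periodLin_{χ′}((conj ψ)|_{T′}) = conj (∫_{D_{T′}} ψ · conj χ′)` for continuous `ψ`. -/
theorem periodLin_chi'_conj_eq (hc' : Continuous R.chi') {ψ : GA W → ℂ} (hψ : Continuous ψ) :
    periodLin W R.μT' R.DT' R.chi' (restrictTo W (torusT' W) (fun x => conj (ψ x))) =
      conj ((Setting.ofAdelicData W R μ DG fdG compG compT compT').periodT' R.chi'
        (restrictTo W (torusT' W) ψ)) := by
  haveI : IsFiniteMeasureOnCompacts R.μT' := (inferInstance : R.μT'.IsHaarMeasure).toIsFiniteMeasureOnCompacts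
  have hint : Integrable (fun t : torusT' W => R.chi' t * restrictTo W (torusT' W) (fun x => conj (ψ x)) t)
      (R.μT'.restrict R.DT') := by
    refine integrableOn_of_continuous_of_isCompact_closure R.μT' compT' ?_
    exact hc'.mul (Complex.continuous_conj.comp (hψ.comp continuous_subtype_val))
  unfold RTF.Setting.periodT'
  rw [periodLin_eq_integral W R.μT' R.DT' R.chi' hint, ← integral_conj]
  refine integral_congr_ae (Filter.Eventually.of_forall fun t => ?_)
  simp only [restrictTo, map_mul, Complex.conj_conj]
  ring

/-- **the `T`-period of the wall on a conjugate vector is the conjugate of the setting's `T`-period**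
(`conj_periodT_eq` read through `periodT_eq_periodLin`). -/
theorem periodLin_chi_conj_eq (hc : Continuous R.chi) {ψ : GA W → ℂ} (hψ : Continuous ψ) :
    periodLin W R.μT R.DT R.chi (restrictTo W (torusT W) (fun x => conj (ψ x))) =
      conj ((Setting.ofAdelicData W R μ DG fdG compG compT compT').periodT R.chi
        (restrictTo W (torusT W) ψ)) := by
  rw [conj_periodT_eq W R μ DG fdG compG compT compT' hc hψ]
  rfl

end Bridge

section Wall

variable {k : Type} [Field k] [NumberField k] (W : PlaneData k) [MeasurableSpace (GA W)] [BorelSpace (GA W)]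
  (R : RTFData W) (μ : Measure (GA W)) [μ.IsHaarMeasure] [R.μT.IsHaarMeasure] [R.μT'.IsHaarMeasure]
  (DG : Set (GA W)) (fdG : IsFundamentalDomain (rationalPoints W) DG μ) (compG : IsCompact (closure DG))
  (compT : IsCompact (closure R.DT)) (compT' : IsCompact (closure R.DT'))

/-- **THE TWO-VECTOR WALL W3⁗ FROM THE SPECTRAL EXPANSION** (cut C-L4-2VEC): from an adapted ONB of the setting, a compact
open level `K`, the stability of `kTypeSpace' … K (V (n j))` under the conjugates of `R(f̄₁) φ_j`, `R(f₂ˇ) φ_j`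
(the projector shape), `Jc(f₁ ⋆ f₂) ≠ 0` and admissibility of the hit constituents: some admissible `V₀` and level
`K₀` carry a vector of `kTypeSpace' … K₀ V₀` with non-zero `T′`-period and one with non-zero `T`-period. -/
theorem mixed_two_torus_W3_twoVector (hc : Continuous R.chi) (hu : ∀ a, ‖R.chi a‖ = 1)
    (hc' : Continuous R.chi') (hunit' : ∀ t, ‖R.chi' t‖ = 1)
    (q : QuadData k) (g g' : Matrix (Fin 4) (Fin 4) k) (w₀ : InfinitePlace k)
    (eP eM eP' eM' : InfinitePlace k → ℤ) (V : ℕ → Submodule ℂ (GA W → ℂ))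
    (K : Subgroup (GA W)) (hK : IsCompactOpenIn W (finitePart W) K)
    {τ : ℕ → Set (GA W → ℂ)} {φ : ℕ → GA W → ℂ} {n : ℕ → ℕ}
    (hB : (Setting.ofAdelicData W R μ DG fdG compG compT compT').IsAdaptedONB τ φ n)
    {f₁ f₂ : GA W → ℂ} (h₁ : IsTestFn W f₁) (h₂ : IsTestFn W f₂)
    (hst₁ : ∀ j, (fun x => conj (rightRegular W μ (RTF.cj f₁) (φ j) x)) ∈
      kTypeSpace' W q g g' eP' eM' K (V (n j)))
    (hst₂ : ∀ j, (fun x => conj (rightRegular W μ (RTF.refl f₂) (φ j) x)) ∈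
      kTypeSpace' W q g g' eP' eM' K (V (n j)))
    (hadm : ∀ m, (Setting.ofAdelicData W R μ DG fdG compG compT compT').Hit (RTF.cj f₁) (τ m) →
      IsAdmissibleS W (Setting.ofAdelicData W R μ DG fdG compG compT compT') q g g' w₀ eP eM eP' eM' (V m))
    (hJ : R.Jc ((Setting.ofAdelicData W R μ DG fdG compG compT compT').conv f₁ f₂) ≠ 0) :
    ∃ V₀ : Submodule ℂ (GA W → ℂ),
      IsAdmissibleS W (Setting.ofAdelicData W R μ DG fdG compG compT compT') q g g' w₀ eP eM eP' eM' V₀ ∧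
      ∃ K₀ : Subgroup (GA W), IsCompactOpenIn W (finitePart W) K₀ ∧
        (∃ f ∈ kTypeSpace' W q g g' eP' eM' K₀ V₀,
          periodLin W R.μT' R.DT' R.chi' (restrictTo W (torusT' W) f) ≠ 0) ∧
        ∃ f ∈ kTypeSpace' W q g g' eP' eM' K₀ V₀,
          periodLin W R.μT R.DT R.chi (restrictTo W (torusT W) f) ≠ 0 := by
  set S := Setting.ofAdelicData W R μ DG fdG compG compT compT' with hS
  haveI := t2Space_GA W
  have h₁' : RTF.IsTest f₁ := ⟨h₁.1, h₁.2⟩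
  have h₂' : RTF.IsTest f₂ := ⟨h₂.1, h₂.2⟩
  have hconv : IsTestFn W (S.conv f₁ f₂) :=
    ⟨(S.conv_isTest h₁' h₂').1.cont, (S.conv_isTest h₁' h₂').1.compact⟩
  have hJ' : S.J R.chi R.chi' (S.conv f₁ f₂) ≠ 0 := by
    rw [← Jc_eq_J W R μ DG fdG compG compT compT' hc hc' hconv]
    exact hJ
  -- a non-zero block, then a non-zero term
  obtain ⟨m, hm⟩ := S.exists_specBlock_ne_zero R.chi R.chi' φ n f₁ f₂
    (isCharacter_chi W R μ DG fdG compG compT compT' hc hu)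
    (isCharacter'_chi' W R μ DG fdG compG compT compT' hc' hunit') hB h₁' h₂' hJ'
  obtain ⟨j, hnj, hterm⟩ := S.exists_specTerm_ne_zero_of_specBlock_ne_zero R.chi R.chi' φ n f₁ f₂ hm
  -- the two factors
  have hterm' := hterm
  unfold RTF.Setting.specTerm at hterm'
  have hP' : S.periodT' R.chi' (fun t' => S.R (RTF.refl f₂) (φ j) t') ≠ 0 := left_ne_zero_of_mul hterm'
  have hP : conj (S.periodT R.chi (fun t => S.R (RTF.cj f₁) (φ j) t)) ≠ 0 := right_ne_zero_of_mul hterm'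
  -- the hit constituent is admissible
  have hhit : S.Hit (RTF.cj f₁) (τ (n j)) := (S.atoms hB h₁' h₂' j hterm).2.2
  -- continuity of the two vectors
  have hc₁ : Continuous (S.R (RTF.cj f₁) (φ j)) :=
    (hB.inv (n j)).cont _ ((hB.inv (n j)).conv (φ j) (hB.mem j) _ h₁'.cj)
  have hc₂ : Continuous (S.R (RTF.refl f₂) (φ j)) :=
    (hB.inv (n j)).cont _ ((hB.inv (n j)).conv (φ j) (hB.mem j) _ h₂'.refl)
  refine ⟨V (n j), hadm (n j) hhit, K, hK, ⟨fun x => conj (rightRegular W μ (RTF.refl f₂) (φ j) x), hst₂ j, ?_⟩,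
    ⟨fun x => conj (rightRegular W μ (RTF.cj f₁) (φ j) x), hst₁ j, ?_⟩⟩
  · rw [← R_ofAdelicData_eq W R μ DG fdG compG compT compT',
      periodLin_chi'_conj_eq W R μ DG fdG compG compT compT' hc' hc₂]
    intro h0
    apply hP'
    have := congrArg conj h0
    rw [Complex.conj_conj, map_zero] at this
    exact this
  · rw [← R_ofAdelicData_eq W R μ DG fdG compG compT compT',
      periodLin_chi_conj_eq W R μ DG fdG compG compT compT' hc hc₁]
    exact hP

end Wall

end Summit.Ventures.HodgeRepro.Tier4.Line4

end
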